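import Summits.PneNP.PneNP.Theorems.ConvexRankGatesCliqueBridge

/-!
# PneNP / ConvexRankGates — the assembly `Assembly` (stmt-PneNP-13895, route rev 5)

Route `PneNP/ConvexRankGates`, item stmt-PneNP-13895 (`Assembly`, rank 1, rev 5):

  `Capture → CliqueExtLowerBound → PneNP`.

The two cruxes alone decide the Statement. Proof: the route's kernel-checked deciding theorem
`Summit.PneNP.PneNP.Theses.ConvexRankGates.closes : Capture → CliqueExtLowerBound → CliqueBridge →
PneNP` (route file, 45 lines: monotonicity of `CLIQUE`, `Capture` applied to the `B₂`-circuit,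
`(t + #E(K_m) + 2)^a ≤ m^{(c+3)a}` for `m ≥ 3`, gate classes monotone in the size parameter) with
its third hypothesis DISCHARGED by the proved support item
`Summit.PneNP.PneNP.Theorems.cliqueBridge_proof : CliqueBridge` (stmt-PneNP-10683,
`Theorems/ConvexRankGatesCliqueBridge.lean`: `¬ PneNP ⟹ NP ⊆ P ⊆ P/poly` by the proved model
bridges, then the `P/poly` circuits for `CLIQUE` restricted to the edge variables contradict a
superpolynomial `B₂` lower bound for `CLIQUE(m, ⌈m^δ⌉₊)`).

This file is NOT `Theorems/ConvexRankGatesAssembly.lean`: that module proves the rev ≤ 4 assembly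
(stmt-PneNP-2666, the 4-ary `Capture → CliqueExtLowerBound → CliqueBridge → PneNP`, by
`exact closes`) and no longer elaborates against the rev-5 route file (its `Assembly` is now
3-ary), so it cannot be appended to.

References: S. Arora, B. Barak, *Computational Complexity: A Modern Approach* (2009), Thm. 6.6;
R. M. Karp, *Reducibility among combinatorial problems* (1972), §4.
-/

namespace Summit.PneNP.PneNP.Theorems

/-- **Assembly of route ConvexRankGates, rev 5** (item stmt-PneNP-13895):
`Capture → CliqueExtLowerBound → PneNP` — the deciding theorem `closes` of the route file with its
hypothesis `CliqueBridge` discharged by `cliqueBridge_proof` (stmt-PneNP-10683).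
[AroraBarak2009, Thm. 6.6; Karp1972, §4] -/
theorem convexRankGates_assembly_rev5_proof :
    Summit.PneNP.PneNP.Theses.ConvexRankGates.Assembly :=
  fun hCap hLB => Summit.PneNP.PneNP.Theses.ConvexRankGates.closes hCap hLB cliqueBridge_proof

end Summit.PneNP.PneNP.Theorems
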